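import Mathlib
import Literature.Analysis.FluidPDE.GaussianVortexPlanar
import Literature.Analysis.FluidPDE.GaussianVortexPlanarProofs
import Literature.Analysis.FluidPDE.BiotSavart2DSymmetry
import Literature.Analysis.FunctionSpaces.SmoothParametricIntegral
import Summits.AnomalousDissipation.AnomalousDissipation.Theorems.MarginalStabilityChainStretchedVortexRowsStubCoreInverseTools
import HarnessLib

/-!
# Circular-mean toolkit (I) toward stub `stub_coreInverse` of the line `braid-closed-large-circulation-gluing`
# (crux stmt-AnomalousDissipation-3009, `MarginalStabilityChain.StretchedVortexRows`)

The **circular mean** (radial part) of a function `u` on `ℝ² = EuclideanSpace ℝ (Fin 2)`,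
`u₀(ξ) = (2π)⁻¹ ∫₀^{2π} u(cos t · ξ + sin t · ξ^⊥) dt` (the average of `u` over all rotations of `ξ`),
enters the energy method for `stub_coreInverse` through the decomposition `u = u₀ + u_⊥` into the radial
part and a remainder with zero circular means. No new definition is introduced: every statement takes the
defining equation `hu₀ : u₀ = fun ξ => (2π)⁻¹ ∫₀^{2π} u(cos t · ξ + sin t · ξ^⊥) dt` as a hypothesis.
This file (part I: algebra and regularity) proves

* the rotation algebra `ρ_t(ρ_s ξ) = ρ_{t+s} ξ`, `ρ_t(r cos θ, r sin θ) = (r cos(θ+t), r sin(θ+t))`, and the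
  existence of an angle `s` with `η = ρ_s ξ` whenever `|ξ| = |η| ≠ 0` (`exists_eq_cos_smul_add_sin_smul_perp`);
* shift invariance of the angular integral (`2π`-periodicity), hence ROTATION INVARIANCE and RADIALITY of `u₀`
  (`circularMean_rotate`, `circularMean_radial`), evenness, the value on circles
  `u₀(r cos θ, r sin θ) = (2π)⁻¹∫₀^{2π} u(r cos t, r sin t) dt` (`circularMean_circlePoint`), and the vanishing
  of the angular derivative `Du₀(ξ)[ξ^⊥] = 0` (`fderiv_circularMean_perp`, from the landed
  `fderiv_perp_eq_zero_of_radial`);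
* REGULARITY: `u ∈ C⁰ ⇒ u₀ ∈ C⁰`, `u ∈ Cⁿ ⇒ u₀ ∈ Cⁿ` (differentiation under the integral sign on a compact
  interval, tree file `SmoothParametricIntegral`, extended here from `C^∞` to every finite order:
  `contDiff_parametric_intervalIntegral_nat`), the derivative formula
  `Du₀(ξ)[v] = (2π)⁻¹∫₀^{2π} Du(ρ_t ξ)[ρ_t v] dt` and the bounds `|u₀| ≤ M`, `‖Du₀‖ ≤ M` under `|u| ≤ M`,
  `‖Du‖ ≤ M` (the rotations `ρ_t` are isometries).

References: Th. Gallay, C. E. Wayne, Comm. Math. Phys. 255 (2005) §4.1 (radial/non-radial decomposition);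
Th. Gallay, Y. Maekawa, arXiv:1610.08384 §4.1.
-/

set_option linter.dupNamespace false

noncomputable section

open scoped RealInnerProductSpace Topology ContDiff
open MeasureTheory WithLp Function Set Real intervalIntegral

namespace Summit.AnomalousDissipation.AnomalousDissipation.Theorems.MarginalStabilityChainStretchedVortexRows

open Literature.Analysis.FluidPDE Literature.Analysis.FunctionSpaces

/-! ### Rotation algebra -/

/-- `(ρ_t ξ)^⊥ = cos t · ξ^⊥ − sin t · ξ`. [folklore] -/
theorem perp_cos_smul_add_sin_smul_perp (ξ : EuclideanSpace ℝ (Fin 2)) (t : ℝ) :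
    perp (Real.cos t • ξ + Real.sin t • perp ξ) = Real.cos t • perp ξ - Real.sin t • ξ := by
  rw [perp_add, perp_smul, perp_smul, perp_perp, smul_neg, sub_eq_add_neg]

/-- Composition of rotations: `ρ_t (ρ_s ξ) = ρ_{t+s} ξ`. [folklore] -/
theorem rotate_rotate (ξ : EuclideanSpace ℝ (Fin 2)) (s t : ℝ) :
    Real.cos t • (Real.cos s • ξ + Real.sin s • perp ξ) +
        Real.sin t • perp (Real.cos s • ξ + Real.sin s • perp ξ) =
      Real.cos (t + s) • ξ + Real.sin (t + s) • perp ξ := by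
  rw [perp_cos_smul_add_sin_smul_perp, Real.cos_add, Real.sin_add]
  module

/-- Rotating a circle point: `ρ_t (r cos θ, r sin θ) = (r cos(θ + t), r sin(θ + t))`. [folklore] -/
theorem rotate_circlePoint (r θ t : ℝ) :
    Real.cos t • (toLp 2 ![r * Real.cos θ, r * Real.sin θ] : EuclideanSpace ℝ (Fin 2)) +
        Real.sin t • perp (toLp 2 ![r * Real.cos θ, r * Real.sin θ]) =
      toLp 2 ![r * Real.cos (θ + t), r * Real.sin (θ + t)] := by
  ext i
  fin_cases i <;> simp [perp, Real.cos_add, Real.sin_add] <;> ring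

/-- Two vectors of the same nonzero length differ by a rotation: `η = cos s · ξ + sin s · ξ^⊥`. [folklore] -/
theorem exists_eq_cos_smul_add_sin_smul_perp {ξ η : EuclideanSpace ℝ (Fin 2)} (hξ : ξ ≠ 0)
    (h : ‖ξ‖ = ‖η‖) : ∃ s : ℝ, η = Real.cos s • ξ + Real.sin s • perp ξ := by
  have hn : ‖ξ‖ ^ 2 ≠ 0 := by positivity
  set a : ℝ := ⟪ξ, η⟫ / ‖ξ‖ ^ 2 with ha
  set b : ℝ := ⟪perp ξ, η⟫ / ‖ξ‖ ^ 2 with hb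
  have hη : η = a • ξ + b • perp ξ := by
    have hc := inner_smul_self_add_inner_perp_smul_perp ξ η
    have h1 : η = (‖ξ‖ ^ 2)⁻¹ • (⟪ξ, η⟫ • ξ + ⟪perp ξ, η⟫ • perp ξ) := by
      rw [hc, smul_smul, inv_mul_cancel₀ hn, one_smul]
    rw [h1, smul_add, smul_smul, smul_smul, ha, hb, div_eq_inv_mul, div_eq_inv_mul]
  have hab : a ^ 2 + b ^ 2 = 1 := by
    have h1 : ‖η‖ ^ 2 = (a ^ 2 + b ^ 2) * ‖ξ‖ ^ 2 := by
      rw [hη, norm_add_sq_real, norm_smul, norm_smul, inner_smul_left, inner_smul_right,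
        inner_self_perp, norm_perp, Real.norm_eq_abs, Real.norm_eq_abs, mul_pow, mul_pow, sq_abs,
        sq_abs]
      simp only [mul_zero, add_zero]
      ring
    rw [← h] at h1
    field_simp at h1
    linarith
  obtain ⟨s, hs⟩ := (Complex.norm_eq_one_iff ⟨a, b⟩).1 (by
    rw [Complex.norm_def, Complex.normSq_mk, Real.sqrt_eq_one]; nlinarith)
  refine ⟨s, ?_⟩
  have hre := congrArg Complex.re hs
  have him := congrArg Complex.im hs
  rw [Complex.exp_ofReal_mul_I_re] at hre
  rw [Complex.exp_ofReal_mul_I_im] at him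
  rw [hη, hre, him]

/-! ### The circular mean: rotation invariance, radiality, value on circles -/

/-- Shift invariance of the angular integral: `∫₀^{2π} u(ρ_{t+s} ξ) dt = ∫₀^{2π} u(ρ_t ξ) dt`. [folklore] -/
theorem intervalIntegral_rotate_add_eq (u : EuclideanSpace ℝ (Fin 2) → ℝ)
    (ξ : EuclideanSpace ℝ (Fin 2)) (s : ℝ) :
    ∫ t in (0:ℝ)..2 * π, u (Real.cos (t + s) • ξ + Real.sin (t + s) • perp ξ) =
      ∫ t in (0:ℝ)..2 * π, u (Real.cos t • ξ + Real.sin t • perp ξ) := by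
  have hper : Periodic (fun t => u (Real.cos t • ξ + Real.sin t • perp ξ)) (2 * π) := fun t => by
    simp only [Real.cos_add_two_pi, Real.sin_add_two_pi]
  rw [intervalIntegral.integral_comp_add_right (fun t => u (Real.cos t • ξ + Real.sin t • perp ξ)) s,
    zero_add, add_comm (2 * π) s]
  have h := hper.intervalIntegral_add_eq s 0
  rwa [zero_add] at h

/-- Shift invariance on circles: `∫₀^{2π} u(r cos(t+θ), r sin(t+θ)) dt = ∫₀^{2π} u(r cos t, r sin t) dt`. [folklore] -/
theorem intervalIntegral_circlePoint_add_eq (u : EuclideanSpace ℝ (Fin 2) → ℝ) (r θ : ℝ) :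
    ∫ t in (0:ℝ)..2 * π, u (toLp 2 ![r * Real.cos (θ + t), r * Real.sin (θ + t)]) =
      ∫ t in (0:ℝ)..2 * π, u (toLp 2 ![r * Real.cos t, r * Real.sin t]) := by
  have hper : Periodic (fun t => u (toLp 2 ![r * Real.cos t, r * Real.sin t])) (2 * π) := fun t => by
    simp only [Real.cos_add_two_pi, Real.sin_add_two_pi]
  simp_rw [add_comm θ]
  rw [intervalIntegral.integral_comp_add_right (fun t => u (toLp 2 ![r * Real.cos t, r * Real.sin t])) θ,
    zero_add, add_comm (2 * π) θ]
  have h := hper.intervalIntegral_add_eq θ 0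
  rwa [zero_add] at h

/-- **Rotation invariance of the circular mean**: `u₀(ρ_s ξ) = u₀(ξ)`. [folklore] -/
theorem circularMean_rotate {u u₀ : EuclideanSpace ℝ (Fin 2) → ℝ}
    (hu₀ : u₀ = fun ξ => (2 * π)⁻¹ * ∫ t in (0:ℝ)..2 * π, u (Real.cos t • ξ + Real.sin t • perp ξ))
    (ξ : EuclideanSpace ℝ (Fin 2)) (s : ℝ) :
    u₀ (Real.cos s • ξ + Real.sin s • perp ξ) = u₀ ξ := by
  subst hu₀
  simp only [rotate_rotate]
  rw [intervalIntegral_rotate_add_eq]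

/-- **The circular mean is radial**: `|ξ| = |η| ⇒ u₀ ξ = u₀ η`. [folklore] -/
theorem circularMean_radial {u u₀ : EuclideanSpace ℝ (Fin 2) → ℝ}
    (hu₀ : u₀ = fun ξ => (2 * π)⁻¹ * ∫ t in (0:ℝ)..2 * π, u (Real.cos t • ξ + Real.sin t • perp ξ))
    (ξ η : EuclideanSpace ℝ (Fin 2)) (h : ‖ξ‖ = ‖η‖) : u₀ ξ = u₀ η := by
  by_cases hξ : ξ = 0
  · have hη : η = 0 := by rwa [hξ, norm_zero, eq_comm, norm_eq_zero] at h
    rw [hξ, hη]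
  · obtain ⟨s, rfl⟩ := exists_eq_cos_smul_add_sin_smul_perp hξ h
    exact (circularMean_rotate hu₀ ξ s).symm

/-- **T1 (registered form): the circular mean `ξ ↦ (2π)⁻¹∫₀^{2π} u(cos t · ξ + sin t · ξ^⊥) dt` is a radial
function** — it takes the same value at any two points of the same norm (rotation of the integration variable
and `2π`-periodicity). [folklore] -/
theorem circAvg_radial :
    ∀ (u : EuclideanSpace ℝ (Fin 2) → ℝ) (ξ η : EuclideanSpace ℝ (Fin 2)), ‖ξ‖ = ‖η‖ →
      ((2 * Real.pi)⁻¹ * ∫ t in (0:ℝ)..(2 * Real.pi), u (Real.cos t • ξ + Real.sin t • perp ξ)) =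
        (2 * Real.pi)⁻¹ * ∫ t in (0:ℝ)..(2 * Real.pi), u (Real.cos t • η + Real.sin t • perp η) :=
  fun u ξ η h => circularMean_radial (u := u) rfl ξ η h

/-- The circular mean is even. [folklore] -/
theorem circularMean_even {u u₀ : EuclideanSpace ℝ (Fin 2) → ℝ}
    (hu₀ : u₀ = fun ξ => (2 * π)⁻¹ * ∫ t in (0:ℝ)..2 * π, u (Real.cos t • ξ + Real.sin t • perp ξ))
    (ξ : EuclideanSpace ℝ (Fin 2)) : u₀ (-ξ) = u₀ ξ :=
  circularMean_radial hu₀ _ _ (norm_neg ξ)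

/-- **Value on circles**: `u₀(r cos θ, r sin θ) = (2π)⁻¹ ∫₀^{2π} u(r cos t, r sin t) dt`. [folklore] -/
theorem circularMean_circlePoint {u u₀ : EuclideanSpace ℝ (Fin 2) → ℝ}
    (hu₀ : u₀ = fun ξ => (2 * π)⁻¹ * ∫ t in (0:ℝ)..2 * π, u (Real.cos t • ξ + Real.sin t • perp ξ))
    (r θ : ℝ) :
    u₀ (toLp 2 ![r * Real.cos θ, r * Real.sin θ]) =
      (2 * π)⁻¹ * ∫ t in (0:ℝ)..2 * π, u (toLp 2 ![r * Real.cos t, r * Real.sin t]) := by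
  subst hu₀
  simp only [rotate_circlePoint]
  rw [intervalIntegral_circlePoint_add_eq]

/-- **The circular mean has no angular derivative**: `Du₀(ξ)[ξ^⊥] = 0` (radiality; no differentiability
needed). [folklore] -/
theorem fderiv_circularMean_perp {u u₀ : EuclideanSpace ℝ (Fin 2) → ℝ}
    (hu₀ : u₀ = fun ξ => (2 * π)⁻¹ * ∫ t in (0:ℝ)..2 * π, u (Real.cos t • ξ + Real.sin t • perp ξ))
    (ξ : EuclideanSpace ℝ (Fin 2)) : fderiv ℝ u₀ ξ (perp ξ) = 0 :=
  fderiv_perp_eq_zero_of_radial (fun ξ η h => circularMean_radial hu₀ ξ η h) ξ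

/-- The angular derivative of the remainder `u − u₀` is that of `u`: `D(u − u₀)(ξ)[ξ^⊥] = Du(ξ)[ξ^⊥]`
(at points where both are differentiable). [folklore] -/
theorem fderiv_sub_circularMean_perp {u u₀ : EuclideanSpace ℝ (Fin 2) → ℝ}
    (hu₀ : u₀ = fun ξ => (2 * π)⁻¹ * ∫ t in (0:ℝ)..2 * π, u (Real.cos t • ξ + Real.sin t • perp ξ))
    {ξ : EuclideanSpace ℝ (Fin 2)} (hu : DifferentiableAt ℝ u ξ) (hu₀d : DifferentiableAt ℝ u₀ ξ) :
    fderiv ℝ (fun η => u η - u₀ η) ξ (perp ξ) = fderiv ℝ u ξ (perp ξ) := by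
  rw [fderiv_fun_sub hu hu₀d, _root_.sub_apply, fderiv_circularMean_perp hu₀, sub_zero]

/-! ### Regularity of parametric interval integrals of finite order -/

/-- **`Cⁿ` dependence on parameters, finite order**: if `H : ℝ × P → F` is `Cⁿ` (`P` finite dimensional) then
so is `p ↦ ∫ σ in a..b, H (σ, p)` (differentiation under the integral sign, induction on `n`; the tree's
`contDiff_parametric_intervalIntegral` is the `C^∞` case). [folklore] -/
theorem contDiff_parametric_intervalIntegral_nat {P : Type*} [NormedAddCommGroup P] [NormedSpace ℝ P]
    [FiniteDimensional ℝ P] {F : Type*} [NormedAddCommGroup F] [NormedSpace ℝ F] (a b : ℝ) :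
    ∀ (n : ℕ) {H : ℝ × P → F}, ContDiff ℝ n H → ContDiff ℝ n fun p : P => ∫ σ in a..b, H (σ, p)
  | 0, H, hH => by
    rw [Nat.cast_zero, contDiff_zero] at hH ⊢
    exact intervalIntegral.continuous_parametric_intervalIntegral_of_continuous'
      (f := fun p σ => H (σ, p)) (hH.comp (continuous_snd.prodMk continuous_fst)) a b
  | n + 1, H, hH => by
    have h1 : ((n + 1 : ℕ) : WithTop ℕ∞) ≠ 0 := by exact_mod_cast Nat.succ_ne_zero n
    rw [Nat.cast_succ, contDiff_succ_iff_fderiv_apply]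
    refine ⟨differentiable_parametric_intervalIntegral hH h1 a b, fun h => ?_, fun v => ?_⟩
    · exact absurd h (by exact_mod_cast WithTop.coe_ne_top)
    · have hv : (fun p : P => fderiv ℝ (fun p : P => ∫ σ in a..b, H (σ, p)) p v) =
          fun p : P => ∫ σ in a..b, fderiv ℝ H (σ, p) ((0 : ℝ), v) :=
        funext fun p => fderiv_parametric_intervalIntegral_apply hH h1 a b p v
      rw [hv]
      refine contDiff_parametric_intervalIntegral_nat a b n
        (H := fun q => fderiv ℝ H q ((0 : ℝ), v)) ?_
      exact (hH.fderiv_right (m := n) (Nat.cast_succ (R := WithTop ℕ∞) n).symm.le).clm_apply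
        contDiff_const

/-! ### Regularity and bounds of the circular mean -/

/-- `ξ ↦ ξ^⊥` is a bounded linear map. [folklore] -/
theorem isBoundedLinearMap_perp :
    IsBoundedLinearMap ℝ (perp : EuclideanSpace ℝ (Fin 2) → EuclideanSpace ℝ (Fin 2)) :=
  ⟨⟨perp_add, perp_smul⟩, 1, one_pos, fun x => by rw [norm_perp, one_mul]⟩

/-- The rotation map `(t, ξ) ↦ ρ_t ξ = cos t · ξ + sin t · ξ^⊥` is smooth. [folklore] -/
theorem contDiff_rotate {n : WithTop ℕ∞} :
    ContDiff ℝ n (fun p : ℝ × EuclideanSpace ℝ (Fin 2) =>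
      Real.cos p.1 • p.2 + Real.sin p.1 • perp p.2) :=
  ((Real.contDiff_cos.comp contDiff_fst).smul contDiff_snd).add
    ((Real.contDiff_sin.comp contDiff_fst).smul (isBoundedLinearMap_perp.contDiff.comp contDiff_snd))

/-- The rotation map is continuous. [folklore] -/
theorem continuous_rotate :
    Continuous (fun p : ℝ × EuclideanSpace ℝ (Fin 2) =>
      Real.cos p.1 • p.2 + Real.sin p.1 • perp p.2) :=
  (contDiff_rotate (n := 0)).continuous

/-- **`u ∈ Cⁿ ⇒ u₀ ∈ Cⁿ`** (`n : ℕ∞`; differentiation under the integral sign). [folklore] -/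
theorem contDiff_circularMean {u u₀ : EuclideanSpace ℝ (Fin 2) → ℝ}
    (hu₀ : u₀ = fun ξ => (2 * π)⁻¹ * ∫ t in (0:ℝ)..2 * π, u (Real.cos t • ξ + Real.sin t • perp ξ))
    {n : ℕ∞} (hu : ContDiff ℝ n u) : ContDiff ℝ n u₀ := by
  subst hu₀
  rw [contDiff_iff_forall_nat_le] at hu ⊢
  intro m hm
  exact contDiff_const.mul
    (contDiff_parametric_intervalIntegral_nat 0 (2 * π) m ((hu m hm).comp contDiff_rotate))

/-- **`u ∈ C⁰ ⇒ u₀ ∈ C⁰`.** [folklore] -/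
theorem continuous_circularMean {u u₀ : EuclideanSpace ℝ (Fin 2) → ℝ}
    (hu₀ : u₀ = fun ξ => (2 * π)⁻¹ * ∫ t in (0:ℝ)..2 * π, u (Real.cos t • ξ + Real.sin t • perp ξ))
    (hu : Continuous u) : Continuous u₀ :=
  (contDiff_circularMean hu₀ (n := 0) (contDiff_zero.2 hu)).continuous

/-- The partial derivative of `(t, ξ) ↦ u(ρ_t ξ)` in `ξ`: `D_ξ[u ∘ ρ](t, ξ)[v] = Du(ρ_t ξ)[ρ_t v]`. [folklore] -/
theorem fderiv_comp_rotate_apply {u : EuclideanSpace ℝ (Fin 2) → ℝ} {n : WithTop ℕ∞}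
    (hu : ContDiff ℝ n u) (hn : n ≠ 0) (t : ℝ) (ξ v : EuclideanSpace ℝ (Fin 2)) :
    fderiv ℝ (fun p : ℝ × EuclideanSpace ℝ (Fin 2) =>
        u (Real.cos p.1 • p.2 + Real.sin p.1 • perp p.2)) (t, ξ) ((0 : ℝ), v) =
      fderiv ℝ u (Real.cos t • ξ + Real.sin t • perp ξ) (Real.cos t • v + Real.sin t • perp v) := by
  obtain ⟨R, hR⟩ := exists_planarRotation (Real.cos t) (Real.sin t) (Real.cos_sq_add_sin_sq t)
  have hH : ContDiff ℝ n (fun p : ℝ × EuclideanSpace ℝ (Fin 2) =>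
      u (Real.cos p.1 • p.2 + Real.sin p.1 • perp p.2)) := hu.comp contDiff_rotate
  have h1 := hasFDerivAt_comp_prodMk hH hn t ξ
  dsimp only at h1
  have h2 : HasFDerivAt (fun q : EuclideanSpace ℝ (Fin 2) => u (Real.cos t • q + Real.sin t • perp q))
      ((fderiv ℝ u (R.toContinuousLinearEquiv ξ)).comp
        (R.toContinuousLinearEquiv : EuclideanSpace ℝ (Fin 2) →L[ℝ] EuclideanSpace ℝ (Fin 2))) ξ := by
    have he : (fun q : EuclideanSpace ℝ (Fin 2) => u (Real.cos t • q + Real.sin t • perp q)) =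
        u ∘ (R.toContinuousLinearEquiv : EuclideanSpace ℝ (Fin 2) → EuclideanSpace ℝ (Fin 2)) := by
      funext q
      simp [hR]
    rw [he]
    exact ((hu.differentiable hn) _).hasFDerivAt.comp ξ R.toContinuousLinearEquiv.hasFDerivAt
  have h3 := DFunLike.congr_fun (h1.unique h2) v
  simp only [ContinuousLinearMap.comp_apply, ContinuousLinearMap.inr_apply] at h3
  rw [h3]
  simp [hR]

/-- **Derivative of the circular mean** = circular mean of the rotated derivative:
`Du₀(ξ)[v] = (2π)⁻¹ ∫₀^{2π} Du(ρ_t ξ)[ρ_t v] dt` for `u ∈ C¹`. [folklore] -/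
theorem fderiv_circularMean_apply {u u₀ : EuclideanSpace ℝ (Fin 2) → ℝ}
    (hu₀ : u₀ = fun ξ => (2 * π)⁻¹ * ∫ t in (0:ℝ)..2 * π, u (Real.cos t • ξ + Real.sin t • perp ξ))
    {n : WithTop ℕ∞} (hu : ContDiff ℝ n u) (hn : n ≠ 0) (ξ v : EuclideanSpace ℝ (Fin 2)) :
    fderiv ℝ u₀ ξ v = (2 * π)⁻¹ * ∫ t in (0:ℝ)..2 * π,
      fderiv ℝ u (Real.cos t • ξ + Real.sin t • perp ξ) (Real.cos t • v + Real.sin t • perp v) := by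
  subst hu₀
  have hH : ContDiff ℝ n (fun p : ℝ × EuclideanSpace ℝ (Fin 2) =>
      u (Real.cos p.1 • p.2 + Real.sin p.1 • perp p.2)) := hu.comp contDiff_rotate
  have hd := differentiable_parametric_intervalIntegral hH hn 0 (2 * π)
  rw [fderiv_const_mul (hd ξ), _root_.smul_apply, smul_eq_mul]
  congr 1
  rw [fderiv_parametric_intervalIntegral_apply hH hn 0 (2 * π) ξ v]
  exact intervalIntegral.integral_congr fun t _ => fderiv_comp_rotate_apply hu hn t ξ v

/-- **`|u| ≤ M ⇒ |u₀| ≤ M`.** [folklore] -/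
theorem abs_circularMean_le {u u₀ : EuclideanSpace ℝ (Fin 2) → ℝ}
    (hu₀ : u₀ = fun ξ => (2 * π)⁻¹ * ∫ t in (0:ℝ)..2 * π, u (Real.cos t • ξ + Real.sin t • perp ξ))
    {M : ℝ} (hM : ∀ ξ, |u ξ| ≤ M) (ξ : EuclideanSpace ℝ (Fin 2)) : |u₀ ξ| ≤ M := by
  subst hu₀
  have h := intervalIntegral.norm_integral_le_of_norm_le_const (a := 0) (b := 2 * π)
    (f := fun t => u (Real.cos t • ξ + Real.sin t • perp ξ)) (C := M)
    (fun t _ => by rw [Real.norm_eq_abs]; exact hM _)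
  rw [sub_zero, abs_of_pos two_pi_pos, Real.norm_eq_abs] at h
  rw [abs_mul, abs_inv, abs_of_pos two_pi_pos]
  calc (2 * π)⁻¹ * |∫ t in (0:ℝ)..2 * π, u (Real.cos t • ξ + Real.sin t • perp ξ)|
      ≤ (2 * π)⁻¹ * (M * (2 * π)) := by gcongr
    _ = M := by field_simp

/-- **`‖Du‖ ≤ M ⇒ ‖Du₀‖ ≤ M`** for `u ∈ C¹` (the rotations are isometries). [folklore] -/
theorem norm_fderiv_circularMean_le {u u₀ : EuclideanSpace ℝ (Fin 2) → ℝ}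
    (hu₀ : u₀ = fun ξ => (2 * π)⁻¹ * ∫ t in (0:ℝ)..2 * π, u (Real.cos t • ξ + Real.sin t • perp ξ))
    {n : WithTop ℕ∞} (hu : ContDiff ℝ n u) (hn : n ≠ 0) {M : ℝ} (hM : ∀ ξ, ‖fderiv ℝ u ξ‖ ≤ M)
    (ξ : EuclideanSpace ℝ (Fin 2)) : ‖fderiv ℝ u₀ ξ‖ ≤ M := by
  have hM0 : 0 ≤ M := (norm_nonneg _).trans (hM 0)
  refine ContinuousLinearMap.opNorm_le_bound _ hM0 fun v => ?_
  rw [fderiv_circularMean_apply hu₀ hu hn ξ v, Real.norm_eq_abs, abs_mul, abs_inv,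
    abs_of_pos two_pi_pos]
  have h := intervalIntegral.norm_integral_le_of_norm_le_const (a := 0) (b := 2 * π)
    (f := fun t => fderiv ℝ u (Real.cos t • ξ + Real.sin t • perp ξ)
      (Real.cos t • v + Real.sin t • perp v)) (C := M * ‖v‖) (fun t _ => by
      calc ‖fderiv ℝ u (Real.cos t • ξ + Real.sin t • perp ξ) (Real.cos t • v + Real.sin t • perp v)‖
          ≤ ‖fderiv ℝ u (Real.cos t • ξ + Real.sin t • perp ξ)‖ * ‖Real.cos t • v + Real.sin t • perp v‖ :=
            ContinuousLinearMap.le_opNorm _ _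
        _ ≤ M * ‖v‖ := by
            rw [norm_cos_smul_add_sin_smul_perp]
            exact mul_le_mul_of_nonneg_right (hM _) (norm_nonneg _))
  rw [sub_zero, abs_of_pos two_pi_pos, Real.norm_eq_abs] at h
  calc (2 * π)⁻¹ * |∫ t in (0:ℝ)..2 * π, fderiv ℝ u (Real.cos t • ξ + Real.sin t • perp ξ)
        (Real.cos t • v + Real.sin t • perp v)|
      ≤ (2 * π)⁻¹ * (M * ‖v‖ * (2 * π)) := by gcongr
    _ = M * ‖v‖ := by field_simp

end Summit.AnomalousDissipation.AnomalousDissipation.Theorems.MarginalStabilityChainStretchedVortexRows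

end
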